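import Literature.LinearAlgebra.RootSystem.ParabolicSubsystemReflections
import Literature.LinearAlgebra.RootSystem.ParabolicSubgroupDoubleCosets
import HarnessLib

/-!
# The subsystem generated by a set of roots and its reflection subgroup
# (Carter 1972 §3 (iii), §4 Lemmas 9–10)

R. W. Carter, *Conjugacy classes in the Weyl group*, Compositio Math. **25** (1972) 1–59 (held text `paper:doi-10-1007-bfb0081548`, pp. 7–9 of
the paper). §3 (iii): "A subsystem of a root system `Φ` is a subset of `Φ` which is itself a root system in the space which it spans. If `W` is
the Weyl group of `Φ`, a Weyl subgroup of `W` is a subgroup generated by the reflections `w_r` corresponding to the roots `r ∈ Φ'`, where `Φ'`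
is a subsystem of `Φ`." §4, proof of Lemma 9: "Let `Φ'` be the smallest root system in `Φ` containing `r_1, r_2, ⋯, r_k`. (The intersection of
all the subsystems of `Φ` containing these vectors)." §4, proof of Lemma 10: "Let `S` be a set of roots corresponding to the nodes of `Γ`. Let
`W_S` be the group generated by the reflections `w_r` for `r ∈ S` and let `Φ' = W_S(S)`. `Φ'` is completely determined by `S`. We show that `Φ'`
is a root system. … To show that `Φ'` is a root system we must verify that if `r, s ∈ Φ'` then `w_r(s) ∈ Φ'`. Now `r = w_1(r_0)` where
`w_1 ∈ W_S`, `r_0 ∈ S`, and `s = w_2(s_0)` where `w_2 ∈ W_S`, `s_0 ∈ S`. Thus `w_r(s) = w_1 w_{r_0} w_1^{-1} w_2(s_0) ∈ Φ'`."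

THIS FILE (lane `lit-hodgefound`, prover seat p40, generation 38, row g38-#6; topic `Literature/LinearAlgebra/RootSystem`, namespace
`Literature.LinearAlgebra.RootSystem(.Base)`) formalizes Carter's construction `Φ' = W_S(S)` for an ARBITRARY set of (indices of) roots
`S : Set ι` of a root pairing `P : RootPairing ι K M N` (Mathlib), with `W_S = Subgroup.closure (s '' S) ≤ Aut P` (`s_i =
RootPairing.Equiv.reflection P i`) and `W_S(S)` the pointwise product `(W_S : Set (Aut P)) • S : Set ι` of Mathlib's `Pointwise` set action
(membership: `j ∈ W_S(S) ⟺ ∃ w ∈ W_S, ∃ i ∈ S, w • i = j`). No definition is introduced; "subsystem" is spelt "closed under its own reflections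
`k ↦ s_j • k`".

## What is proved (THEOREMS ONLY: no definition, no instance, no notation, no named fact; net debt 0)

* §1 **`reflection_smul_mem_closure_image`** (`s_{w r_0} = w s_{r_0} w⁻¹ ∈ W_S` for `w ∈ W_S`, `r_0 ∈ S`), **`subset_closure_image_smul`** (`S ⊆ W_S(S)`),
  **`smul_mem_closure_image_smul`** (`W_S(S)` is `W_S`-stable), **`reflection_mem_closure_image_of_mem_closure_image_smul`** (`s_r ∈ W_S` for
  `r ∈ W_S(S)`), ★★ **`reflection_smul_mem_closure_image_smul`** (LEMMA 10, proof: `W_S(S)` IS CLOSED UNDER ITS OWN REFLECTIONS — it is a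
  subsystem), **`neg_mem_closure_image_smul`** (`W_S(S) = -W_S(S)`), ★ **`closure_image_closure_image_smul_eq`** (THE WEYL SUBGROUP OF THE
  SUBSYSTEM `W_S(S)` IS `W_S`: `⟨s_r : r ∈ W_S(S)⟩ = W_S`), ★ **`smul_set_closure_image_smul`** (transport `g · W_S(S) = W_{gS}(gS)`).
* §2 ★★ **`closure_image_smul_subset_of_forall_reflection_smul_mem`** (LEMMA 9, proof: `W_S(S)` IS THE SMALLEST SUBSYSTEM CONTAINING `S` — every
  reflection-closed `T ⊇ S` contains it), **`root_mem_span_of_mem_closure_image_smul`** (`W_S(S) ⊆ Φ ∩ span S`).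
* §3 ★★ **`Base.closure_image_smul_eq_setOf_root_mem_span`** (for a set `I ⊆ Δ` of SIMPLE roots the subsystem `W_I(I)` is the parabolic
  subsystem `Φ_I = Φ ∩ span Δ_I` of Humphreys §1.10 — tree `ParabolicSubsystemReflections`).

BY NAME, nothing restated: g36-#1 `reflection_smul_eq_conj` ∕ `smul_index_eq` (`WeylGroupSimpleReflections`); g37-#1 `Base.smul_sub_mem_span_of_mem_closure` ∕
`Base.root_mem_span_of_mem` ∕ `Base.closure_image_mono` (`ParabolicSubgroup`); g37-#6 `Base.conj_smul_closure_image` (`ParabolicSubgroupDoubleCosets`); `reflection_indexNeg`,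
`Base.exists_mem_closure_image_smul_eq_or_of_root_mem_span` (`ParabolicSubsystemReflections`); Mathlib `Subgroup.closure_induction_left`,
`Set.mem_smul` (pointwise), `RootPairing.Equiv.reflection_inv`, `RootPairing.Equiv.root_indexEquiv_eq_smul`.

## Scope caveats

"Subsystem" and "Weyl subgroup" are not introduced as definitions (no `def`); the statements are about the explicit set `(W_S : Set (Aut P)) • S`
and the subgroup `Subgroup.closure (s '' S)`. That `W_S(S)` "is itself a root system in the space which it spans" is rendered only as closure under
its reflections (plus `-W_S(S) = W_S(S)`, `W_S(S) ⊆ span S`); no `RootPairing` structure on the span is built. In general `W_S(S) ⊊ Φ ∩ span S`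
(e.g. long roots); equality for simple `S ⊆ Δ` is §3.

## References

* [Carter1972WeylConjugacy] R. W. Carter, *Conjugacy classes in the Weyl group*, Compositio Math. 25 (1972) 1–59 — §3 (iii); §4, proofs of Lemmas 9 and 10.
* [Humphreys1990] J. E. Humphreys, *Reflection Groups and Coxeter Groups*, CUP (1990) — §1.10 Proposition (a) (`Φ_I`, `W_I`).
-/

noncomputable section

open Module Set Function
open Submodule (span)
open Pointwise

namespace Literature.LinearAlgebra.RootSystem

variable {ι K M N : Type*} [Field K] [CharZero K] [AddCommGroup M] [Module K M]
  [AddCommGroup N] [Module K N] [Fintype ι]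
  {P : RootPairing ι K M N} [P.IsCrystallographic] [P.IsReduced]

/-! ## §1 `Φ' = W_S(S)` is a subsystem with Weyl group `W_S` -/

section Subsystem

omit [CharZero K] [Fintype ι] [P.IsCrystallographic] [P.IsReduced] in
/-- `s_{w r_0} = w s_{r_0} w⁻¹ ∈ W_S` for `w ∈ W_S` and `r_0 ∈ S`. [cite: Carter1972WeylConjugacy, §4 Lemma 10 (proof: "w_r(s) = w_1 w_{r_0} w_1^{-1} w_2(s_0)")] -/
theorem reflection_smul_mem_closure_image {S : Set ι} {w : P.Aut}
    (hw : w ∈ Subgroup.closure (RootPairing.Equiv.reflection P '' S)) {i : ι} (hi : i ∈ S) :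
    RootPairing.Equiv.reflection P (w • i) ∈ Subgroup.closure (RootPairing.Equiv.reflection P '' S) := by
  rw [reflection_smul_eq_conj]
  exact mul_mem (mul_mem hw (Subgroup.subset_closure ⟨i, hi, rfl⟩)) (inv_mem hw)

omit [CharZero K] [Fintype ι] [P.IsCrystallographic] [P.IsReduced] in
/-- `S ⊆ W_S(S)`. [cite: Carter1972WeylConjugacy, §4 Lemma 10 (proof: "let Φ' = W_S(S)")] -/
theorem subset_closure_image_smul (S : Set ι) :
    S ⊆ (Subgroup.closure (RootPairing.Equiv.reflection P '' S) : Set P.Aut) • S :=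
  fun i hi ↦ Set.mem_smul.mpr ⟨1, Subgroup.one_mem _, i, hi, one_smul _ _⟩

omit [CharZero K] [Fintype ι] [P.IsCrystallographic] [P.IsReduced] in
/-- `W_S(S)` is stable under `W_S`. [cite: Carter1972WeylConjugacy, §4 Lemma 10 (proof: "Φ' = W_S(S)")] -/
theorem smul_mem_closure_image_smul {S : Set ι} {w : P.Aut} (hw : w ∈ Subgroup.closure (RootPairing.Equiv.reflection P '' S))
    {j : ι} (hj : j ∈ (Subgroup.closure (RootPairing.Equiv.reflection P '' S) : Set P.Aut) • S) :
    w • j ∈ (Subgroup.closure (RootPairing.Equiv.reflection P '' S) : Set P.Aut) • S := by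
  obtain ⟨w', hw', i, hi, rfl⟩ := Set.mem_smul.mp hj
  exact Set.mem_smul.mpr ⟨w * w', mul_mem hw hw', i, hi, mul_smul w w' i⟩

omit [CharZero K] [Fintype ι] [P.IsCrystallographic] [P.IsReduced] in
/-- `s_r ∈ W_S` for every `r ∈ W_S(S)`. [cite: Carter1972WeylConjugacy, §4 Lemma 10 (proof: "r = w_1(r_0) where w_1 ∈ W_S, r_0 ∈ S")] -/
theorem reflection_mem_closure_image_of_mem_closure_image_smul {S : Set ι} {j : ι}
    (hj : j ∈ (Subgroup.closure (RootPairing.Equiv.reflection P '' S) : Set P.Aut) • S) :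
    RootPairing.Equiv.reflection P j ∈ Subgroup.closure (RootPairing.Equiv.reflection P '' S) := by
  obtain ⟨w, hw, i, hi, rfl⟩ := Set.mem_smul.mp hj
  exact reflection_smul_mem_closure_image hw hi

omit [CharZero K] [Fintype ι] [P.IsCrystallographic] [P.IsReduced] in
/-- ★★ **CARTER 1972 §4 LEMMA 10, PROOF: `Φ' = W_S(S)` IS A ROOT (SUB)SYSTEM — `r, s ∈ Φ' ⟹ w_r(s) ∈ Φ'`** («Now `r = w_1(r_0)` where `w_1 ∈ W_S`,
`r_0 ∈ S`, and `s = w_2(s_0)` where `w_2 ∈ W_S`, `s_0 ∈ S`. Thus `w_r(s) = w_1 w_{r_0} w_1^{-1} w_2(s_0) ∈ Φ'`»), for an arbitrary set `S` of roots.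
[cite: Carter1972WeylConjugacy, §4 Lemma 10 (proof: "To show that Φ' is a root system we must verify that if r, s ∈ Φ' then w_r(s) ∈ Φ'")] -/
theorem reflection_smul_mem_closure_image_smul {S : Set ι} {j k : ι}
    (hj : j ∈ (Subgroup.closure (RootPairing.Equiv.reflection P '' S) : Set P.Aut) • S)
    (hk : k ∈ (Subgroup.closure (RootPairing.Equiv.reflection P '' S) : Set P.Aut) • S) :
    RootPairing.Equiv.reflection P j • k ∈ (Subgroup.closure (RootPairing.Equiv.reflection P '' S) : Set P.Aut) • S :=
  smul_mem_closure_image_smul (reflection_mem_closure_image_of_mem_closure_image_smul hj) hk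

omit [CharZero K] [Fintype ι] [P.IsCrystallographic] [P.IsReduced] in
/-- `Φ' = -Φ'`: with `r` the subsystem `W_S(S)` contains `-r = w_r(r)`. [cite: Carter1972WeylConjugacy, §3 (iii) ("a subset of Φ which is itself a root system")] -/
theorem neg_mem_closure_image_smul {S : Set ι} {j : ι}
    (hj : j ∈ (Subgroup.closure (RootPairing.Equiv.reflection P '' S) : Set P.Aut) • S) :
    letI := P.indexNeg
    (-j) ∈ (Subgroup.closure (RootPairing.Equiv.reflection P '' S) : Set P.Aut) • S :=
  reflection_smul_mem_closure_image_smul hj hj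

omit [CharZero K] [Fintype ι] [P.IsCrystallographic] [P.IsReduced] in
/-- ★ **THE WEYL SUBGROUP OF THE SUBSYSTEM `Φ' = W_S(S)` IS `W_S`**: `⟨w_r : r ∈ Φ'⟩ = ⟨w_r : r ∈ S⟩`.
[cite: Carter1972WeylConjugacy, §3 (iii) ("a Weyl subgroup of W is a subgroup generated by the reflections w_r corresponding to the roots r ∈ Φ'") and §4 Lemma 10 (proof)] -/
theorem closure_image_closure_image_smul_eq (S : Set ι) :
    Subgroup.closure (RootPairing.Equiv.reflection P ''
        ((Subgroup.closure (RootPairing.Equiv.reflection P '' S) : Set P.Aut) • S)) =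
      Subgroup.closure (RootPairing.Equiv.reflection P '' S) := by
  refine le_antisymm ?_ (Base.closure_image_mono (subset_closure_image_smul S))
  rw [Subgroup.closure_le]
  rintro _ ⟨j, hj, rfl⟩
  exact reflection_mem_closure_image_of_mem_closure_image_smul hj

omit [CharZero K] [Fintype ι] [P.IsCrystallographic] [P.IsReduced] in
/-- ★ **Transport: `g · W_S(S) = W_{gS}(gS)`** for every automorphism `g` (with `g W_S g⁻¹ = W_{gS}`, tree `Base.conj_smul_closure_image`) — «if
`w = w_{r_1} ⋯ w_{r_{k+h}}`, we have `w'ww'^{-1} = w_{s_1} ⋯ w_{s_{k+h}}` where `s_i = w'(r_i)`». [cite: Carter1972WeylConjugacy, §3, remark after Lemma 7 ("any conjugate of w also has a decomposition with graph Γ")] -/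
theorem smul_set_closure_image_smul (g : P.Aut) (S : Set ι) :
    g • ((Subgroup.closure (RootPairing.Equiv.reflection P '' S) : Set P.Aut) • S) =
      (Subgroup.closure (RootPairing.Equiv.reflection P '' (g • S)) : Set P.Aut) • (g • S) := by
  ext k
  rw [← Base.conj_smul_closure_image, Subgroup.coe_pointwise_smul]
  constructor
  · rintro ⟨_, hmem, rfl⟩
    obtain ⟨w, hw, i, hi, rfl⟩ := Set.mem_smul.mp hmem
    refine Set.mem_smul.mpr ⟨MulAut.conj g • w, Set.smul_mem_smul_set hw, g • i, Set.smul_mem_smul_set hi, ?_⟩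
    rw [MulAut.smul_def, MulAut.conj_apply, mul_smul, mul_smul, inv_smul_smul]
  · intro hk
    obtain ⟨_, hw', _, hi', rfl⟩ := Set.mem_smul.mp hk
    obtain ⟨w, hw, rfl⟩ := Set.mem_smul_set.mp hw'
    obtain ⟨i, hi, rfl⟩ := Set.mem_smul_set.mp hi'
    refine Set.mem_smul_set.mpr ⟨w • i, Set.mem_smul.mpr ⟨w, hw, i, hi, rfl⟩, ?_⟩
    rw [MulAut.smul_def, MulAut.conj_apply, mul_smul, mul_smul, inv_smul_smul]

end Subsystem

/-! ## §2 `W_S(S)` is the smallest subsystem containing `S`, and lies in `span S` -/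

section Smallest

omit [CharZero K] [Fintype ι] [P.IsCrystallographic] [P.IsReduced] in
/-- ★★ **CARTER 1972 §4 LEMMA 9, PROOF: `W_S(S)` IS THE SMALLEST ROOT (SUB)SYSTEM CONTAINING `S`** — every set of roots `T ⊇ S` closed under its
own reflections (`r, s ∈ T ⟹ w_r(s) ∈ T`) contains `W_S(S)` («the smallest root system in `Φ` containing `r_1, r_2, ⋯, r_k` (the intersection of
all the subsystems of `Φ` containing these vectors)»). [cite: Carter1972WeylConjugacy, §4 Lemma 9 (proof) and Lemma 10 (proof: "Φ' is completely determined by S")] -/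
theorem closure_image_smul_subset_of_forall_reflection_smul_mem {S T : Set ι} (hST : S ⊆ T)
    (hT : ∀ j ∈ T, ∀ k ∈ T, RootPairing.Equiv.reflection P j • k ∈ T) :
    (Subgroup.closure (RootPairing.Equiv.reflection P '' S) : Set P.Aut) • S ⊆ T := by
  intro k hk
  obtain ⟨w, hw, i, hi, rfl⟩ := Set.mem_smul.mp hk
  clear hk
  -- every `w ∈ W_S` maps `T` into `T` (the generators `s_r`, `r ∈ S ⊆ T`, do, and `s_r⁻¹ = s_r`)
  suffices h : ∀ k ∈ T, w • k ∈ T from h i (hST hi)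
  induction hw using Subgroup.closure_induction_left with
  | one => intro k hk; rwa [one_smul]
  | mul_left g hg y _ ih =>
    obtain ⟨j, hj, rfl⟩ := hg
    intro k hk
    rw [mul_smul]
    exact hT j (hST hj) _ (ih k hk)
  | inv_mul_cancel g hg y _ ih =>
    obtain ⟨j, hj, rfl⟩ := hg
    intro k hk
    rw [mul_smul, RootPairing.Equiv.reflection_inv]
    exact hT j (hST hj) _ (ih k hk)

omit [CharZero K] [Fintype ι] [P.IsCrystallographic] [P.IsReduced] in
/-- **`W_S(S) ⊆ Φ ∩ span S`**: every root of the subsystem generated by `S` lies in the span of `S` («a root system in the space which it spans»;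
`w r_0 = r_0 + (w r_0 - r_0)` with `w r_0 - r_0 ∈ span S` for `w ∈ W_S`). [cite: Carter1972WeylConjugacy, §3 (iii) and §4 Lemma 9 (proof: "Φ' is an indecomposable root system of rank k")] -/
theorem root_mem_span_of_mem_closure_image_smul {S : Set ι} {j : ι}
    (hj : j ∈ (Subgroup.closure (RootPairing.Equiv.reflection P '' S) : Set P.Aut) • S) :
    P.root j ∈ span K (P.root '' S) := by
  obtain ⟨w, hw, i, hi, rfl⟩ := Set.mem_smul.mp hj
  rw [smul_index_eq, RootPairing.Equiv.root_indexEquiv_eq_smul]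
  have h := Submodule.add_mem _ (Base.smul_sub_mem_span_of_mem_closure hw (P.root i)) (Base.root_mem_span_of_mem (P := P) (K := K) hi)
  rwa [sub_add_cancel] at h

end Smallest

/-! ## §3 For simple roots: `W_I(I) = Φ_I` -/

section Parabolic

namespace Base

variable (b : P.Base)

include b in
/-- ★★ **FOR A SET `I ⊆ Δ` OF SIMPLE ROOTS, CARTER'S SUBSYSTEM `W_I(I)` IS HUMPHREYS' PARABOLIC SUBSYSTEM `Φ_I = Φ ∩ span Δ_I`** (`⊆` by §2; `⊇`:
every `α ∈ Φ_I` is `±wα_j`, `w ∈ W_I`, `j ∈ I` — tree — and `W_I(I) = -W_I(I)`). [cite: Humphreys1990, §1.10 Proposition (a), p. 19 ("Φ_I is a root system in V_I … with simple system Δ_I and with corresponding reflection group W_I")] [cite: Carter1972WeylConjugacy, §3 (iii)] -/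
theorem closure_image_smul_eq_setOf_root_mem_span {I : Set ι} (hI : I ⊆ b.support) :
    (Subgroup.closure (RootPairing.Equiv.reflection P '' I) : Set P.Aut) • I = {i : ι | P.root i ∈ span K (P.root '' I)} := by
  letI := P.indexNeg
  refine Set.Subset.antisymm (fun j hj ↦ root_mem_span_of_mem_closure_image_smul hj) fun i hi ↦ ?_
  obtain ⟨w, hw, j, hj, h⟩ := exists_mem_closure_image_smul_eq_or_of_root_mem_span b hI hi
  have hwj : w • j ∈ (Subgroup.closure (RootPairing.Equiv.reflection P '' I) : Set P.Aut) • I := Set.mem_smul.mpr ⟨w, hw, j, hj, rfl⟩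
  rcases h with h | h
  · rwa [h] at hwj
  · have h2 := neg_mem_closure_image_smul hwj
    rwa [h, neg_neg] at h2

end Base

end Parabolic

end Literature.LinearAlgebra.RootSystem
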